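import Summits.AtomisticToContinuum.FouriersLaw.Theorems.BondHeatUncertaintyExtensiveSnapshotIrreversibilityClausiusBudgetKinetics
import Mathlib.Analysis.Calculus.Deriv.Slope
import Mathlib.Analysis.SpecificLimits.Basic
import HarnessLib

/-!
# Clausius budget, part 3a: dissipativity of the window response `k_t = ∫₀ᵗ P_s g ds` against test functions

Support file for crux `stmt-AtomisticToContinuum-9121` (`BondHeatUncertainty.ExtensiveSnapshotIrreversibility`),
line `clausius-budget-sound-window`, stub `stub_clausiusBudget`. Pinned anharmonic chain `pinnedChain ω₂ lam β γ`
(`ω₂ > 0`, `lam ≥ 0`, `β, γ > 0`), both baths at `T > 0`, equilibrium kernels `P_t`, Gibbs state `μ_T`, a nice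
continuous source `g = O(e^{ϑH})` (`2ϑ < 1/T`), `Pg s = P_{s⁺} g`, `k t = ∫₀ᵗ Pg s ds`:

* `pinnedChain_window_dissipative` — `∫ (LF - (P_t g - g)) (F - k_t) dμ_T ≤ 0` for test functions `F`
  (`⟨Au, u⟩ ≤ 0` for `u = F - k_t` at the kernel level: contraction, Dynkin, the semigroup identity
  `P_ε k_t = k_{t+ε} - k_ε`, time continuity, dominated convergence);
* `pinnedChain_window_core` — **the core property** (`N ≥ 2`): test functions `F_n → k_t` with
  `LF_n → P_t g - g` in `L²(μ_T)`, from the density of `Range(1 - L)|C_c^∞` in `L²(μ_T)`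
  (`OddSectorIrreversibility.exists_testFunction_resolvent_approx`: Hörmander regularity + generator
  detailed balance + dissipativity) and the a priori bound `‖F - k_t‖ ≤ ‖(F - LF) - (k_t - (P_t g - g))‖`.
  This is the essential m-dissipativity of `(L, C_c^∞)` in `L²(μ_T)` (Helffer–Nier 2005, Prop. 5.5;
  Eckmann–Pillet–Rey-Bellet 1999) specialised to the vector `k_t`; registered sub-goal `pinnedChain_windowCore`.
Also: Cauchy–Schwarz as `|∫ f g| ≤ √∫f² √∫g²`. No definitions; nothing here closes an item.
-/

noncomputable section

namespace Summit.AtomisticToContinuum.FouriersLaw.Theorems.ExtensiveSnapshotIrreversibility.ClausiusBudget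

open MeasureTheory ProbabilityTheory Filter Topology Set
open scoped ENNReal NNReal ContDiff
open Literature.MathematicalPhysics.KineticTheory.HeatConduction
open Literature.MathematicalPhysics.KineticTheory
open Summit.AtomisticToContinuum.FouriersLaw.Theorems.SubdiffusiveBondHeat

variable {N : ℕ}

/-! ### Cauchy–Schwarz -/

/-- **Cauchy–Schwarz** for real square-integrable functions: `|∫ f g dμ| ≤ √(∫ f²) √(∫ g²)`. [folklore] -/
theorem abs_integral_mul_le_sqrt_mul_sqrt {α : Type*} [MeasurableSpace α] {μ : Measure α}
    {f g : α → ℝ} (hf : MemLp f 2 μ) (hg : MemLp g 2 μ) :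
    |∫ x, f x * g x ∂μ| ≤ Real.sqrt (∫ x, f x ^ 2 ∂μ) * Real.sqrt (∫ x, g x ^ 2 ∂μ) := by
  have h2 : ENNReal.ofReal (2 : ℝ) = 2 := by simp
  have hH := integral_mul_norm_le_Lp_mul_Lq (μ := μ) Real.HolderConjugate.two_two
    (by rw [h2]; exact hf) (by rw [h2]; exact hg)
  have ef : ∫ x, ‖f x‖ ^ (2 : ℝ) ∂μ = ∫ x, f x ^ 2 ∂μ :=
    integral_congr_ae (Eventually.of_forall fun x => by
      simp only [Real.rpow_two, Real.norm_eq_abs, sq_abs])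
  have eg : ∫ x, ‖g x‖ ^ (2 : ℝ) ∂μ = ∫ x, g x ^ 2 ∂μ :=
    integral_congr_ae (Eventually.of_forall fun x => by
      simp only [Real.rpow_two, Real.norm_eq_abs, sq_abs])
  rw [ef, eg] at hH
  have e1 : (∫ x, f x ^ 2 ∂μ) ^ (1 / (2 : ℝ)) = Real.sqrt (∫ x, f x ^ 2 ∂μ) := by
    rw [Real.sqrt_eq_rpow]
  have e2 : (∫ x, g x ^ 2 ∂μ) ^ (1 / (2 : ℝ)) = Real.sqrt (∫ x, g x ^ 2 ∂μ) := by
    rw [Real.sqrt_eq_rpow]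
  rw [e1, e2] at hH
  calc |∫ x, f x * g x ∂μ| ≤ ∫ x, |f x * g x| ∂μ := abs_integral_le_integral_abs
    _ = ∫ x, ‖f x‖ * ‖g x‖ ∂μ :=
        integral_congr_ae (Eventually.of_forall fun x => by
          simp only [abs_mul, Real.norm_eq_abs])
    _ ≤ _ := hH


section Core

variable {ω₂ lam β γ : ℝ} (hω : 0 < ω₂) (hl : 0 ≤ lam) (hβ : 0 < β) (hγ : 0 < γ) (hN : 0 < N)
  {T : ℝ} (hT : 0 < T)
include hω hl hβ hγ hN hT

omit hω hl hβ hγ hN hT in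
/-- Averages of a continuous function over shrinking intervals: `(ε_n)⁻¹ ∫_a^{a+ε_n} φ → φ(a)` along
`ε_n = 1/(n+1)` (the right derivative of the primitive). [folklore] -/
theorem tendsto_inv_mul_intervalIntegral {φ : ℝ → ℝ} (hφ : Continuous φ) (a : ℝ) :
    Tendsto (fun n : ℕ => (1 / ((n : ℝ) + 1))⁻¹ * ∫ s in a..(a + 1 / ((n : ℝ) + 1)), φ s) atTop (𝓝 (φ a)) := by
  have hG : HasDerivAt (fun x => ∫ s in a..x, φ s) (φ a) a :=
    intervalIntegral.integral_hasDerivAt_right (hφ.intervalIntegrable _ _)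
      (hφ.stronglyMeasurableAtFilter _ _) hφ.continuousAt
  have h1 := hG.tendsto_slope_zero_right
  have hε : Tendsto (fun n : ℕ => 1 / ((n : ℝ) + 1)) atTop (𝓝[>] 0) :=
    tendsto_nhdsWithin_iff.2 ⟨tendsto_one_div_add_atTop_nhds_zero_nat,
      Eventually.of_forall fun n => by
        show 0 < 1 / ((n : ℝ) + 1)
        positivity⟩
  have h2 := h1.comp hε
  refine h2.congr fun n => ?_
  simp only [Function.comp_apply, intervalIntegral.integral_same, sub_zero, smul_eq_mul]

omit hω hl hβ hγ hN hT in
/-- The average of a function bounded by `B` on `[a, a + ε]` (`ε > 0`) is bounded by `B`. [folklore] -/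
theorem abs_inv_mul_intervalIntegral_le {φ : ℝ → ℝ} {a ε B : ℝ} (hε : 0 < ε)
    (hB : ∀ s, |φ s| ≤ B) : |ε⁻¹ * ∫ s in a..(a + ε), φ s| ≤ B := by
  have h := intervalIntegral.norm_integral_le_of_norm_le_const (a := a) (b := a + ε) (C := B) (f := φ)
    (fun s _ => by rw [Real.norm_eq_abs]; exact hB s)
  rw [Real.norm_eq_abs, show a + ε - a = ε by ring, abs_of_pos hε] at h
  rw [abs_mul, abs_inv, abs_of_pos hε, inv_mul_le_iff₀ hε, mul_comm]
  exact h

/-- **Dissipativity of the window response against test functions.** For the pinned chain at temperature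
`T`, a nice continuous source `g` (`|g| ≤ M e^{ϑH}`, `0 < ϑ`, `2ϑ < 1/T`), `Pg s = P_{s⁺} g`,
`k t = ∫₀ᵗ Pg s ds`, every test function `F` and `t ≥ 0`:

  `∫ (LF - (P_t g - g)) · (F - k_t) dμ_T ≤ 0`.

This is `⟨A u, u⟩ ≤ 0` for `u = F - k_t` and the `L²(μ_T)`-generator `A` of the semigroup, proved at the
kernel level: `⟨P_ε u - u, u⟩ ≤ 0` (contraction + Cauchy–Schwarz), and `(P_ε u - u)/ε → LF - (P_t g - g)`
in `L²(μ_T)` as `ε ↓ 0` — Dynkin's formula `P_ε F - F = ∫₀^ε P_s LF ds`, the semigroup identity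
`P_ε k_t = k_{t+ε} - k_ε`, time continuity of `P_s LF`, `P_s g`, and dominated convergence with the weight
`e^{2ϑH} ∈ L¹(μ_T)`. [cite: CuneoEckmannHairerReyBellet2018, §3 eq. (3.4)] -/
theorem pinnedChain_window_dissipative {ϑ M : ℝ} (hϑ : 0 < ϑ) (h2ϑ : 2 * ϑ < 1 / T) (hM : 0 ≤ M)
    {g : PhaseSpace N → ℝ} (hg : Continuous g)
    (hgM : ∀ y, |g y| ≤ M * Real.exp (ϑ * (pinnedChain ω₂ lam β γ).hamiltonian N y))
    (Pg : ℝ → PhaseSpace N → ℝ)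
    (hPg : Pg = fun s z => ∫ y, g y ∂((pinnedChain ω₂ lam β γ).transitionKernel N T T s.toNNReal z))
    (k : ℝ → PhaseSpace N → ℝ) (hk : k = fun τ z => ∫ s in (0 : ℝ)..τ, Pg s z)
    {F : PhaseSpace N → ℝ} (hF : ContDiff ℝ (⊤ : ℕ∞) F) (hFc : HasCompactSupport F) {t : ℝ} (ht : 0 ≤ t) :
    MemLp (fun z => F z - k t z) 2 ((pinnedChain ω₂ lam β γ).gibbsMeasure N T) ∧
    MemLp (fun z => (pinnedChain ω₂ lam β γ).generator N T T F z - (Pg t z - g z)) 2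
      ((pinnedChain ω₂ lam β γ).gibbsMeasure N T) ∧
    ∫ z, ((pinnedChain ω₂ lam β γ).generator N T T F z - (Pg t z - g z)) * (F z - k t z)
      ∂((pinnedChain ω₂ lam β γ).gibbsMeasure N T) ≤ 0 := by
  set P := pinnedChain ω₂ lam β γ with hP
  set κ := P.transitionKernel N T T with hκ
  set H := P.hamiltonian N with hH
  set μ := P.gibbsMeasure N T with hμ
  haveI hMk : ∀ s, IsMarkovKernel (κ s) := fun s =>
    pinnedChain_isMarkovKernel_transitionKernel hω hl hβ.le hγ.le N T T s
  haveI : IsProbabilityMeasure μ := pinnedChain_isProbabilityMeasure_gibbsMeasure hω hl hβ.le γ N hT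
  have hϑ1 : ϑ < 1 / T := by linarith
  obtain ⟨hcont, ⟨C, hC0, hPgb, hkb⟩, hSM, hkreg, hwin⟩ :=
    pinnedChain_act_window hω hl hβ hγ hN hT hϑ h2ϑ hM hg hgM Pg hPg k hk
  have hPg_apply : ∀ s z, Pg s z = ∫ y, g y ∂(κ s.toNNReal z) := fun s z => by rw [hPg]
  have hk_apply : ∀ τ z, k τ z = ∫ s in (0 : ℝ)..τ, Pg s z := fun τ z => by rw [hk]
  -- the test function and its generator image
  have hU1 : ContDiff ℝ 1 P.U := pinnedChain_contDiff_U ω₂ lam β γ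
  have hV1 : ContDiff ℝ 1 P.V := pinnedChain_contDiff_V ω₂ lam β γ
  have hF2 : ContDiff ℝ 2 F := hF.of_le (by norm_cast)
  have hFcont : Continuous F := hF.continuous
  set LF : PhaseSpace N → ℝ := P.generator N T T F with hLF
  have hLFc : Continuous LF := P.continuous_generator hU1 hV1 N T T hF2
  obtain ⟨CL, hCL⟩ := P.exists_bound_generator hU1 hV1 N T T hF2 hFc
  obtain ⟨CF, hCF⟩ := hFcont.bounded_above_of_compact_support hFc
  have hCL0 : 0 ≤ CL := (norm_nonneg _).trans (hCL 0)
  have hCF0 : 0 ≤ CF := (norm_nonneg _).trans (hCF 0)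
  have hHc : Continuous H := pinnedChain_continuous_hamiltonian ω₂ lam β γ N
  have hE1 : ∀ z, 1 ≤ Real.exp (ϑ * H z) := fun z =>
    Real.one_le_exp (mul_nonneg hϑ.le (pinnedChain_hamiltonian_nonneg hω.le hl hβ.le γ N z))
  -- `P_s LF`, `P_s F`: continuity in `s`, values at `s = 0`
  set PL : ℝ → PhaseSpace N → ℝ := fun s z => ∫ y, LF y ∂(κ s.toNNReal z) with hPL
  have hPLc : ∀ z, Continuous fun s => PL s z := fun z =>
    pinnedChain_continuous_integral_transitionKernel_time hω hl hβ hγ hLFc hCL z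
  have hPLb : ∀ s z, |PL s z| ≤ CL := fun s z => by
    have h := norm_integral_le_of_norm_le_const (μ := κ s.toNNReal z) (Eventually.of_forall hCL)
    simpa [probReal_univ] using h
  have hκ0 : κ (0 : ℝ).toNNReal = Kernel.id := by
    rw [Real.toNNReal_zero, hκ, pinnedChain_transitionKernel_zero hω hl hβ.le hγ.le N T T]
  have hPL0 : ∀ z, PL 0 z = LF z := fun z => by
    simp only [hPL]; rw [hκ0, Kernel.id_apply, integral_dirac]
  have hPg0 : ∀ z, Pg 0 z = g z := fun z => by
    rw [hPg_apply, hκ0, Kernel.id_apply, integral_dirac]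
  -- Dynkin: `P_ε F - F = ∫₀^ε P_s LF ds`
  have hDyn : ∀ ε : ℝ, 0 ≤ ε → ∀ z, (∫ y, F y ∂(κ ε.toNNReal z)) - F z = ∫ s in (0 : ℝ)..ε, PL s z := by
    intro ε hε z
    have h := pinnedChain_dynkin hω hl hβ.le hγ.le hN hT.le hT.le F hF hFc ε.toNNReal z
    rw [Real.coe_toNNReal _ hε] at h
    exact h
  -- `u = F - k_t`, `v = LF - (P_t g - g)`
  set u : PhaseSpace N → ℝ := fun z => F z - k t z with hu
  set v : PhaseSpace N → ℝ := fun z => LF z - (Pg t z - g z) with hv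
  obtain ⟨hkSM, hkL2⟩ := hkreg t ht
  have huSM : StronglyMeasurable u := hFcont.stronglyMeasurable.sub hkSM
  have hub : ∀ z, |u z| ≤ (CF + t * C) * Real.exp (ϑ * H z) := fun z => by
    have h1 : |F z| ≤ CF := by have := hCF z; rwa [Real.norm_eq_abs] at this
    have h2 := hkb t ht z
    calc |u z| ≤ |F z| + |k t z| := abs_sub _ _
      _ ≤ CF * Real.exp (ϑ * H z) + t * C * Real.exp (ϑ * H z) := by
          nlinarith [hE1 z, Real.exp_pos (ϑ * H z)]
      _ = _ := by ring
  have hPgtSM : StronglyMeasurable (Pg t) := hSM.comp_measurable measurable_prodMk_left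
  have hvSM : StronglyMeasurable v := hLFc.stronglyMeasurable.sub (hPgtSM.sub hg.stronglyMeasurable)
  -- the weight `e^{ϑH}` in `L²(μ_T)` and the resulting memberships
  have hVc : Continuous fun z => Real.exp (ϑ * H z) := Real.continuous_exp.comp (continuous_const.mul hHc)
  have hexp2 : MemLp (fun z => Real.exp (ϑ * H z)) 2 μ := by
    rw [memLp_two_iff_integrable_sq hVc.aestronglyMeasurable]
    refine (pinnedChain_integrable_exp_mul_hamiltonian_gibbsMeasure hω hl hβ.le γ N hT h2ϑ).congr
      (Eventually.of_forall fun z => ?_)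
    change Real.exp (2 * ϑ * H z) = Real.exp (ϑ * H z) ^ 2
    rw [sq, ← Real.exp_add]; congr 1; ring
  have hL2 : ∀ {f : PhaseSpace N → ℝ} (K : ℝ), StronglyMeasurable f →
      (∀ z, |f z| ≤ K * Real.exp (ϑ * H z)) → MemLp f 2 μ := fun K hf hb =>
    hexp2.of_le_mul (c := K) hf.aestronglyMeasurable (Eventually.of_forall fun z => by
      rw [Real.norm_eq_abs, Real.norm_eq_abs, abs_of_pos (Real.exp_pos _)]; exact hb z)
  have huL2 : MemLp u 2 μ := hL2 _ huSM hub
  -- the sequence `ε_n = 1/(n+1)` and the difference quotients `D_n = (P_{ε_n} u - u)/ε_n`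
  set ε : ℕ → ℝ := fun n => 1 / ((n : ℝ) + 1) with hε
  have hεpos : ∀ n, 0 < ε n := fun n => by rw [hε]; positivity
  set D : ℕ → PhaseSpace N → ℝ := fun n z => (ε n)⁻¹ * ((∫ y, u y ∂(κ (ε n).toNNReal z)) - u z) with hD
  -- (i) the kernels acting on `u`
  have hVint : ∀ (s : ℝ≥0) (z : PhaseSpace N), Integrable (fun y => Real.exp (ϑ * H y)) (κ s z) := fun s z =>
    pinnedChain_integrable_exp_mul_hamiltonian_transitionKernel hω hl hT hβ.le hγ.le hN hϑ hϑ1 s z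
  have hFint : ∀ (s : ℝ≥0) z, Integrable F (κ s z) := fun s z =>
    (integrable_const CF).mono' hFcont.aestronglyMeasurable (Eventually.of_forall hCF)
  have hktint : ∀ (s : ℝ≥0) z, Integrable (k t) (κ s z) := fun s z =>
    ((hVint s z).const_mul (t * C)).mono' hkSM.aestronglyMeasurable (Eventually.of_forall fun y => by
      rw [Real.norm_eq_abs]; exact hkb t ht y)
  have hPu : ∀ n z, ∫ y, u y ∂(κ (ε n).toNNReal z) =
      (∫ y, F y ∂(κ (ε n).toNNReal z)) - (k (ε n + t) z - k (ε n) z) := by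
    intro n z
    rw [← hwin (ε n) t (hεpos n).le ht z]
    exact integral_sub (hFint _ z) (hktint _ z)
  -- (ii) `∫ D_n u ≤ 0`
  have hDu : ∀ n, ∫ z, D n z * u z ∂μ ≤ 0 := by
    intro n
    obtain ⟨hu2, hPu2, hcontr⟩ := pinnedChain_integral_sq_act_le_of_stronglyMeasurable hω hl hβ hγ hN hT hϑ h2ϑ
      huSM hub (ε n).toNNReal
    set Pu : PhaseSpace N → ℝ := fun z => ∫ y, u y ∂(κ (ε n).toNNReal z) with hPudef
    have hPuSM : StronglyMeasurable Pu := huSM.integral_kernel (κ := κ (ε n).toNNReal)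
    have hPuL2 : MemLp Pu 2 μ := (memLp_two_iff_integrable_sq hPuSM.aestronglyMeasurable).2 hPu2
    have hCS := abs_integral_mul_le_sqrt_mul_sqrt hPuL2 huL2
    have hsq : Real.sqrt (∫ z, Pu z ^ 2 ∂μ) ≤ Real.sqrt (∫ z, u z ^ 2 ∂μ) := Real.sqrt_le_sqrt hcontr
    have h1 : ∫ z, Pu z * u z ∂μ ≤ ∫ z, u z ^ 2 ∂μ := by
      have h2 : Real.sqrt (∫ z, Pu z ^ 2 ∂μ) * Real.sqrt (∫ z, u z ^ 2 ∂μ) ≤ ∫ z, u z ^ 2 ∂μ := by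
        calc _ ≤ Real.sqrt (∫ z, u z ^ 2 ∂μ) * Real.sqrt (∫ z, u z ^ 2 ∂μ) :=
              mul_le_mul_of_nonneg_right hsq (Real.sqrt_nonneg _)
          _ = ∫ z, u z ^ 2 ∂μ := Real.mul_self_sqrt (integral_nonneg fun z => sq_nonneg _)
      exact (le_abs_self _).trans (hCS.trans h2)
    have hi1 : Integrable (fun z => Pu z * u z) μ := hPuL2.integrable_mul huL2
    have hi2 : Integrable (fun z => u z ^ 2) μ := hu2
    have e : (fun z => D n z * u z) = fun z => (ε n)⁻¹ * (Pu z * u z - u z ^ 2) := by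
      funext z; simp only [hD, hPudef]; ring
    rw [e, integral_const_mul, integral_sub hi1 hi2]
    exact mul_nonpos_of_nonneg_of_nonpos (inv_nonneg.2 (hεpos n).le) (by linarith)
  -- (iii) `D_n - v → 0` pointwise, with the domination `K e^{ϑH}`
  have hDv : ∀ n z, D n z - v z =
      ((ε n)⁻¹ * (∫ s in (0 : ℝ)..(0 + ε n), PL s z) - LF z) -
        ((ε n)⁻¹ * (∫ s in t..(t + ε n), Pg s z) - Pg t z) +
        ((ε n)⁻¹ * (∫ s in (0 : ℝ)..(0 + ε n), Pg s z) - g z) := by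
    intro n z
    have hint : ∀ a b : ℝ, IntervalIntegrable (fun r => Pg r z) volume a b := fun a b =>
      (hcont z).intervalIntegrable a b
    have e1 : k (ε n + t) z - k t z = ∫ s in t..(t + ε n), Pg s z := by
      rw [hk_apply, hk_apply, add_comm (ε n) t,
        ← intervalIntegral.integral_add_adjacent_intervals (hint 0 t) (hint t (t + ε n))]
      ring
    have e2 : k (ε n) z = ∫ s in (0 : ℝ)..(0 + ε n), Pg s z := by rw [hk_apply, zero_add]
    have e3 : (∫ y, F y ∂(κ (ε n).toNNReal z)) - F z = ∫ s in (0 : ℝ)..(0 + ε n), PL s z := by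
      rw [zero_add]; exact hDyn (ε n) (hεpos n).le z
    simp only [hD, hu, hv]
    rw [hPu n z]
    have e4 : (∫ y, F y ∂(κ (ε n).toNNReal z)) = F z + ∫ s in (0 : ℝ)..(0 + ε n), PL s z := by linarith
    rw [e4, show k (ε n + t) z = k t z + ∫ s in t..(t + ε n), Pg s z by linarith, e2]
    ring
  set K : ℝ := 2 * CL + 3 * C + M with hK
  have hDvb : ∀ n z, |D n z - v z| ≤ K * Real.exp (ϑ * H z) := by
    intro n z
    rw [hDv n z]
    have a1 : |(ε n)⁻¹ * (∫ s in (0 : ℝ)..(0 + ε n), PL s z) - LF z| ≤ 2 * CL := by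
      have h1 := abs_inv_mul_intervalIntegral_le (a := 0) (hεpos n) (fun s => hPLb s z)
      have h2 : |LF z| ≤ CL := by have := hCL z; rwa [Real.norm_eq_abs] at this
      calc _ ≤ |(ε n)⁻¹ * ∫ s in (0 : ℝ)..(0 + ε n), PL s z| + |LF z| := abs_sub _ _
        _ ≤ CL + CL := add_le_add h1 h2
        _ = 2 * CL := by ring
    have a2 : |(ε n)⁻¹ * (∫ s in t..(t + ε n), Pg s z) - Pg t z| ≤ 2 * C * Real.exp (ϑ * H z) := by
      have h1 := abs_inv_mul_intervalIntegral_le (a := t) (hεpos n) (fun s => hPgb s z)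
      calc _ ≤ |(ε n)⁻¹ * ∫ s in t..(t + ε n), Pg s z| + |Pg t z| := abs_sub _ _
        _ ≤ C * Real.exp (ϑ * H z) + C * Real.exp (ϑ * H z) := add_le_add h1 (hPgb t z)
        _ = _ := by ring
    have a3 : |(ε n)⁻¹ * (∫ s in (0 : ℝ)..(0 + ε n), Pg s z) - g z| ≤ (C + M) * Real.exp (ϑ * H z) := by
      have h1 := abs_inv_mul_intervalIntegral_le (a := 0) (hεpos n) (fun s => hPgb s z)
      calc _ ≤ |(ε n)⁻¹ * ∫ s in (0 : ℝ)..(0 + ε n), Pg s z| + |g z| := abs_sub _ _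
        _ ≤ C * Real.exp (ϑ * H z) + M * Real.exp (ϑ * H z) := add_le_add h1 (hgM z)
        _ = _ := by ring
    have hpos := Real.exp_pos (ϑ * H z)
    calc _ ≤ |(ε n)⁻¹ * (∫ s in (0 : ℝ)..(0 + ε n), PL s z) - LF z -
            ((ε n)⁻¹ * (∫ s in t..(t + ε n), Pg s z) - Pg t z)| +
          |(ε n)⁻¹ * (∫ s in (0 : ℝ)..(0 + ε n), Pg s z) - g z| := abs_add_le _ _
      _ ≤ (2 * CL + 2 * C * Real.exp (ϑ * H z)) + (C + M) * Real.exp (ϑ * H z) :=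
          add_le_add ((abs_sub _ _).trans (add_le_add a1 a2)) a3
      _ ≤ K * Real.exp (ϑ * H z) := by rw [hK]; nlinarith [hE1 z]
  have hDvlim : ∀ z, Tendsto (fun n => D n z - v z) atTop (𝓝 0) := by
    intro z
    have tA := tendsto_inv_mul_intervalIntegral (hPLc z) 0
    have tB := tendsto_inv_mul_intervalIntegral (hcont z) t
    have tC := tendsto_inv_mul_intervalIntegral (hcont z) 0
    rw [hPL0 z] at tA
    rw [hPg0 z] at tC
    have h := ((tA.sub_const (LF z)).sub (tB.sub_const (Pg t z))).add (tC.sub_const (g z))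
    simp only [sub_self, add_zero] at h
    refine h.congr fun n => ?_
    rw [hDv n z]
  -- (iv) `∫ (D_n - v)² → 0` by dominated convergence
  have hK0 : 0 ≤ K := by rw [hK]; positivity
  have hDvSM : ∀ n, StronglyMeasurable fun z => D n z - v z := by
    intro n
    have h1 : StronglyMeasurable fun z => ∫ y, u y ∂(κ (ε n).toNNReal z) :=
      huSM.integral_kernel (κ := κ (ε n).toNNReal)
    exact ((stronglyMeasurable_const.mul (h1.sub huSM)).sub hvSM)
  have hI2ϑ := pinnedChain_integrable_exp_mul_hamiltonian_gibbsMeasure hω hl hβ.le γ N hT h2ϑ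
  have hsqlim : Tendsto (fun n => ∫ z, (D n z - v z) ^ 2 ∂μ) atTop (𝓝 0) := by
    have h0 : (0 : ℝ) = ∫ _ : PhaseSpace N, (0 : ℝ) ∂μ := by simp
    rw [h0]
    refine tendsto_integral_of_dominated_convergence (fun z => K ^ 2 * Real.exp (2 * ϑ * H z))
      (fun n => ((hDvSM n).measurable.pow_const 2).aestronglyMeasurable) (hI2ϑ.const_mul _)
      (fun n => ae_of_all _ fun z => ?_) (ae_of_all _ fun z => ?_)
    · rw [Real.norm_eq_abs, abs_of_nonneg (sq_nonneg _), show K ^ 2 * Real.exp (2 * ϑ * H z) =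
        (K * Real.exp (ϑ * H z)) ^ 2 by rw [mul_pow, ← Real.exp_nat_mul]; ring_nf, ← sq_abs]
      exact pow_le_pow_left₀ (abs_nonneg _) (hDvb n z) 2
    · have := (hDvlim z).pow 2
      simpa using this
  -- (v) conclusion: `∫ v u = lim ∫ D_n u ≤ 0`
  have hvL2 : MemLp v 2 μ := by
    refine hL2 (CL + C + M) hvSM fun z => ?_
    have h1 : |LF z| ≤ CL := by have := hCL z; rwa [Real.norm_eq_abs] at this
    calc |v z| ≤ |LF z| + |Pg t z - g z| := abs_sub _ _
      _ ≤ |LF z| + (|Pg t z| + |g z|) := by gcongr; exact abs_sub _ _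
      _ ≤ CL * Real.exp (ϑ * H z) + (C * Real.exp (ϑ * H z) + M * Real.exp (ϑ * H z)) := by
          gcongr
          · nlinarith [hE1 z]
          · exact hPgb t z
          · exact hgM z
      _ = _ := by ring
  have hDvL2 : ∀ n, MemLp (fun z => D n z - v z) 2 μ := fun n => hL2 K (hDvSM n) (hDvb n)
  have hDL2 : ∀ n, MemLp (D n) 2 μ := fun n => by
    have h := (hDvL2 n).add hvL2
    have e : ((fun z => D n z - v z) + v) = D n := by funext z; simp
    rwa [e] at h
  have hvu_int : Integrable (fun z => v z * u z) μ := hvL2.integrable_mul huL2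
  have hlim : Tendsto (fun n => ∫ z, D n z * u z ∂μ) atTop (𝓝 (∫ z, v z * u z ∂μ)) := by
    rw [tendsto_iff_norm_sub_tendsto_zero]
    have hbound : ∀ n, ‖(∫ z, D n z * u z ∂μ) - ∫ z, v z * u z ∂μ‖ ≤
        Real.sqrt (∫ z, (D n z - v z) ^ 2 ∂μ) * Real.sqrt (∫ z, u z ^ 2 ∂μ) := by
      intro n
      have hi : Integrable (fun z => D n z * u z) μ := (hDL2 n).integrable_mul huL2
      rw [← integral_sub hi hvu_int, Real.norm_eq_abs]
      have e : (fun z => D n z * u z - v z * u z) = fun z => (D n z - v z) * u z := by funext z; ring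
      rw [e]
      exact abs_integral_mul_le_sqrt_mul_sqrt (hDvL2 n) huL2
    refine squeeze_zero (fun n => norm_nonneg _) hbound ?_
    have h := (hsqlim.sqrt).mul_const (Real.sqrt (∫ z, u z ^ 2 ∂μ))
    simpa using h
  refine ⟨huL2, hvL2, ?_⟩
  show ∫ z, v z * u z ∂μ ≤ 0
  exact le_of_tendsto' hlim hDu

end Core

/-- **Registered sub-goal `pinnedChain_windowDissipative`** of crux stmt-AtomisticToContinuum-9121 (under
`stub_clausiusBudget`): `pinnedChain_window_dissipative` in closed form. [cite: CuneoEckmannHairerReyBellet2018, §3 eq. (3.4)] -/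
theorem pinnedChain_windowDissipative : ∀ ω₂ lam β γ : ℝ, 0 < ω₂ → 0 ≤ lam → 0 < β → 0 < γ → ∀ (N : ℕ), 0 < N → ∀ T : ℝ, 0 < T → ∀ ϑ M : ℝ, 0 < ϑ → 2 * ϑ < 1 / T → 0 ≤ M → ∀ g : PhaseSpace N → ℝ, Continuous g → (∀ y, |g y| ≤ M * Real.exp (ϑ * (pinnedChain ω₂ lam β γ).hamiltonian N y)) → ∀ Pg : ℝ → PhaseSpace N → ℝ, Pg = (fun s z => ∫ y, g y ∂((pinnedChain ω₂ lam β γ).transitionKernel N T T s.toNNReal z)) → ∀ k : ℝ → PhaseSpace N → ℝ, k = (fun τ z => ∫ s in (0 : ℝ)..τ, Pg s z) → ∀ F : PhaseSpace N → ℝ, ContDiff ℝ (⊤ : ℕ∞) F → HasCompactSupport F → ∀ t : ℝ, 0 ≤ t → MemLp (fun z => F z - k t z) 2 ((pinnedChain ω₂ lam β γ).gibbsMeasure N T) ∧ MemLp (fun z => (pinnedChain ω₂ lam β γ).generator N T T F z - (Pg t z - g z)) 2 ((pinnedChain ω₂ lam β γ).gibbsMeasure N T) ∧ ∫ z, ((pinnedChain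 ω₂ lam β γ).generator N T T F z - (Pg t z - g z)) * (F z - k t z) ∂((pinnedChain ω₂ lam β γ).gibbsMeasure N T) ≤ 0 :=
  fun _ _ _ _ hω hl hβ hγ _ hN _ hT _ _ hϑ h2ϑ hM _ hg hgM Pg hPg k hk _ hF hFc _ ht =>
    pinnedChain_window_dissipative hω hl hβ hγ hN hT hϑ h2ϑ hM hg hgM Pg hPg k hk hF hFc ht

end Summit.AtomisticToContinuum.FouriersLaw.Theorems.ExtensiveSnapshotIrreversibility.ClausiusBudget

end
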